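import Mathlib
import HarnessLib
import Literature.MathematicalPhysics.QuantumLattice.KohnLuttinger
import Summits.HubbardSuperconductivity.HubbardSuperconductivity.Theorems.WeakCouplingBCSWcbcsKohnLuttingerB1gReduction
import Summits.HubbardSuperconductivity.HubbardSuperconductivity.Theorems.ChiralWindowCwChannelInfContinuousChemicalPotential

/-!
# Route `WeakCouplingBCS` — support item `WcbcsKohnLuttingerB1g` (stmt-HubbardSuperconductivity-0158):
# doping window ↔ chemical-potential window for the `t' = 0` band

The item quantifies over hole dopings `δ ∈ [a,b]` through
`μ(δ) = chemicalPotentialOfDensity ε (1-δ) = sInf {μ | 1-δ ≤ n(μ)}` (`KohnLuttinger.lean`), whereas a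
certificate is computed on a window of chemical potentials. Building on the filling API of
`ChiralWindowCwChannelInfContinuousFilling/ChemicalPotential` (`filling_eq`, `strictMonoOn_filling`,
`chemicalPotentialOfDensity_spec`), this file adds, for `ε = squareDispersion 1 0`:

* `volume_brillouinZone = (2π)²` and the **particle–hole bound** `two_mul_volume_neg_le`:
  `2 vol({ε < 0} ∩ BZ) ≤ vol BZ` — the four translations by `(±π, ±π)` (sign chosen by the
  quadrant) map `{ε < 0} ∩ BZ` injectively into `{ε > 0} ∩ BZ`, since `ε(p + (±π,±π)) = -ε(p)`;
  hence `filling_le_one_of_nonpos` (`n(μ) ≤ 1` for `μ ≤ 0`) and `filling_lt_one_of_neg`;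
* `chemicalPotentialOfDensity_window`: for `-4 < μ₂ < μ₁ < 0`, with `a = 1 - n(μ₁)`, `b = 1 - n(μ₂)`,
  one has `0 < a < b < 1` and `μ(δ) ∈ [μ₂, μ₁]` for all `δ ∈ [a,b]` (no value of `n` is computed, so
  the window is existential, exactly as the item's `∃ a b`).

References: S. Raghu, S. A. Kivelson, D. J. Scalapino, Phys. Rev. B 81 (2010) 224505, §II (4).
-/

noncomputable section

-- the tree's namespace `Summit.<Summit>.<Problem>.Theorems` repeats the summit name by design (D-0017)
set_option linter.dupNamespace false

namespace Summit.HubbardSuperconductivity.HubbardSuperconductivity.Theorems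

open MeasureTheory Literature.MathematicalPhysics.QuantumLattice Real

/-! ### The volume of the Brillouin zone -/

/-- The Brillouin zone is the preimage of the box `[-π, π)²` under the coordinate map. [folklore] -/
theorem brillouinZone_eq_preimage :
    brillouinZone = (WithLp.ofLp : Momentum → (Fin 2 → ℝ)) ⁻¹'
      Set.pi Set.univ (fun _ : Fin 2 => Set.Ico (-π) π) := by
  ext k
  simp [brillouinZone]

/-- **The Brillouin zone `[-π,π)²` has volume `(2π)²`.** [folklore] -/
theorem volume_brillouinZone : volume brillouinZone = ENNReal.ofReal (2 * π) ^ 2 := by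
  rw [brillouinZone_eq_preimage, (PiLp.volume_preserving_ofLp (Fin 2)).measure_preimage
    ((MeasurableSet.univ_pi fun _ => measurableSet_Ico).nullMeasurableSet), Real.volume_pi_Ico]
  simp only [Finset.prod_const, Finset.card_univ, Fintype.card_fin]
  congr 1
  ring_nf

/-! ### The particle–hole bound at half filling -/

/-- **Particle–hole bound**: twice the volume of the Fermi sea at `μ = 0` is at most the volume of
the Brillouin zone. The four translations by `(±π, ±π)` (sign chosen by the quadrant) map
`{ε < 0} ∩ BZ` injectively into `{ε > 0} ∩ BZ`, since `ε(p + (±π, ±π)) = -ε(p)`. [folklore] -/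
theorem two_mul_volume_neg_le :
    2 * volume (brillouinZone ∩ {p : Momentum | squareDispersion 1 0 p < 0}) ≤ volume brillouinZone := by
  have hε : Measurable (squareDispersion 1 0) := measurable_squareDispersion 1 0
  have hform : ∀ p : Momentum, squareDispersion 1 0 p = -2 * (cos (p 0) + cos (p 1)) :=
    squareDispersion_one_zero_apply
  set N := brillouinZone ∩ {p : Momentum | squareDispersion 1 0 p < 0} with hN
  set P := brillouinZone ∩ {p : Momentum | 0 < squareDispersion 1 0 p} with hP
  have hNm : MeasurableSet N := measurableSet_brillouinZone.inter (measurableSet_lt hε measurable_const)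
  have hPm : MeasurableSet P := measurableSet_brillouinZone.inter (measurableSet_lt measurable_const hε)
  -- translation vectors and pieces, indexed by the quadrant (is p 0 < 0 ?, is p 1 < 0 ?)
  let sh : Bool → ℝ := fun b => if b then π else -π
  let v : Bool × Bool → Momentum := fun s => WithLp.toLp 2 ![sh s.1, sh s.2]
  let piece : Bool × Bool → Set Momentum := fun s =>
    N ∩ ({p : Momentum | (p 0 < 0 ↔ s.1 = true)} ∩ {p : Momentum | (p 1 < 0 ↔ s.2 = true)})
  let T : Bool × Bool → Set Momentum := fun s => (· + v s) '' piece s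
  have hcoordm : ∀ i : Fin 2, Measurable fun p : Momentum => p i := fun i => by fun_prop
  have hpiece_m : ∀ s, MeasurableSet (piece s) := by
    intro s
    have hc : ∀ (i : Fin 2) (b : Bool), MeasurableSet {p : Momentum | (p i < 0 ↔ b = true)} := by
      intro i b
      cases b
      · have : {p : Momentum | (p i < 0 ↔ false = true)} = {p : Momentum | p i < 0}ᶜ := by
          ext p; simp
        rw [this]
        exact (measurableSet_lt (hcoordm i) measurable_const).compl
      · have : {p : Momentum | (p i < 0 ↔ true = true)} = {p : Momentum | p i < 0} := by
          ext p; simp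
        rw [this]
        exact measurableSet_lt (hcoordm i) measurable_const
    exact hNm.inter ((hc 0 s.1).inter (hc 1 s.2))
  have hT_m : ∀ s, MeasurableSet (T s) := by
    intro s
    change MeasurableSet ((· + v s) '' piece s)
    rw [Set.image_add_right]
    exact (hpiece_m s).preimage (measurable_add_const _)
  -- N is covered by the pieces
  have hNcover : N ⊆ ⋃ s ∈ (Finset.univ : Finset (Bool × Bool)), piece s := by
    intro p hp
    simp only [Finset.mem_univ, Set.iUnion_true, Set.mem_iUnion]
    refine ⟨(decide (p 0 < 0), decide (p 1 < 0)), hp, ?_, ?_⟩ <;> simp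
  -- the shifted coordinate: stays in `[-π, π)`, flips the quadrant, flips the cosine
  have hshift : ∀ (x : ℝ) (b : Bool), x ∈ Set.Ico (-π) π → (x < 0 ↔ b = true) →
      x + sh b ∈ Set.Ico (-π) π ∧ (0 ≤ x + sh b ↔ b = true) ∧ cos (x + sh b) = -cos x := by
    intro x b hx hb
    cases b
    · simp only [Bool.false_eq_true, iff_false, not_lt] at hb
      refine ⟨⟨?_, ?_⟩, ?_, ?_⟩
      · show -π ≤ x + -π; linarith
      · show x + -π < π; linarith [hx.2]
      · simp only [Bool.false_eq_true, iff_false, not_le]; show x + -π < 0; linarith [hx.2]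
      · show cos (x + -π) = -cos x; rw [← sub_eq_add_neg, Real.cos_sub_pi]
    · simp only [iff_true] at hb
      refine ⟨⟨?_, ?_⟩, ?_, ?_⟩
      · show -π ≤ x + π; linarith [hx.1]
      · show x + π < π; linarith
      · simp only [iff_true]; show 0 ≤ x + π; linarith [hx.1]
      · show cos (x + π) = -cos x; exact Real.cos_add_pi x
  -- images land in P, in the quadrant determined by s
  have hTsub : ∀ s, T s ⊆ P ∩ {q | (0 ≤ q 0 ↔ s.1 = true) ∧ (0 ≤ q 1 ↔ s.2 = true)} := by
    rintro s q ⟨p, ⟨⟨hpBZ, hpN⟩, hp0, hp1⟩, rfl⟩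
    have h0 := hshift (p 0) s.1 (hpBZ 0) hp0
    have h1 := hshift (p 1) s.2 (hpBZ 1) hp1
    have hq0 : (p + v s) 0 = p 0 + sh s.1 := by simp [v]
    have hq1 : (p + v s) 1 = p 1 + sh s.2 := by simp [v]
    refine ⟨⟨?_, ?_⟩, ?_, ?_⟩
    · intro i
      fin_cases i
      · show (p + v s) 0 ∈ _; rw [hq0]; exact h0.1
      · show (p + v s) 1 ∈ _; rw [hq1]; exact h1.1
    · show 0 < squareDispersion 1 0 (p + v s)
      rw [hform, hq0, hq1, h0.2.2, h1.2.2]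
      have hpN' : squareDispersion 1 0 p < 0 := hpN
      rw [hform] at hpN'
      linarith
    · show (0 ≤ (p + v s) 0 ↔ s.1 = true); rw [hq0]; exact h0.2.1
    · show (0 ≤ (p + v s) 1 ↔ s.2 = true); rw [hq1]; exact h1.2.1
  have hTdisj : Set.PairwiseDisjoint (↑(Finset.univ : Finset (Bool × Bool))) T := by
    intro s _ s' _ hss'
    rw [Function.onFun, Set.disjoint_left]
    intro q hq hq'
    have h := (hTsub s hq).2
    have h' := (hTsub s' hq').2
    apply hss'
    ext
    · have := h.1.symm.trans h'.1
      cases hs : s.1 <;> cases hs' : s'.1 <;> simp_all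
    · have := h.2.symm.trans h'.2
      cases hs : s.2 <;> cases hs' : s'.2 <;> simp_all
  -- vol N ≤ Σ vol (piece s) = Σ vol (T s) = vol (⋃ T s) ≤ vol P
  have h1 : volume N ≤ ∑ s ∈ (Finset.univ : Finset (Bool × Bool)), volume (piece s) :=
    (measure_mono hNcover).trans (measure_biUnion_finset_le _ _)
  have h2 : ∀ s, volume (piece s) = volume (T s) := by
    intro s
    change volume (piece s) = volume ((· + v s) '' piece s)
    rw [Set.image_add_right, measure_preimage_add_right]
  have h3 : ∑ s ∈ (Finset.univ : Finset (Bool × Bool)), volume (T s) =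
      volume (⋃ s ∈ (Finset.univ : Finset (Bool × Bool)), T s) :=
    (measure_biUnion_finset hTdisj fun s _ => hT_m s).symm
  have h4 : (⋃ s ∈ (Finset.univ : Finset (Bool × Bool)), T s) ⊆ P := by
    intro q hq
    simp only [Finset.mem_univ, Set.iUnion_true, Set.mem_iUnion] at hq
    obtain ⟨s, hs⟩ := hq
    exact (hTsub s hs).1
  have hNP : volume N ≤ volume P := by
    calc volume N ≤ ∑ s ∈ (Finset.univ : Finset (Bool × Bool)), volume (piece s) := h1
      _ = ∑ s ∈ (Finset.univ : Finset (Bool × Bool)), volume (T s) := Finset.sum_congr rfl fun s _ => h2 s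
      _ = volume (⋃ s ∈ (Finset.univ : Finset (Bool × Bool)), T s) := h3
      _ ≤ volume P := measure_mono h4
  have hdisj : Disjoint N P := by
    rw [Set.disjoint_left]
    rintro p ⟨-, hp⟩ ⟨-, hp'⟩
    have h1 : squareDispersion 1 0 p < 0 := hp
    have h2 : 0 < squareDispersion 1 0 p := hp'
    exact lt_irrefl _ (h1.trans h2)
  calc 2 * volume N = volume N + volume N := two_mul _
    _ ≤ volume N + volume P := add_le_add le_rfl hNP
    _ = volume (N ∪ P) := (measure_union hdisj hPm).symm
    _ ≤ volume brillouinZone :=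
        measure_mono (Set.union_subset Set.inter_subset_left Set.inter_subset_left)

/-- The filling of the `t' = 0` band at `μ ≤ 0` is at most one (half filling). [folklore] -/
theorem filling_le_one_of_nonpos {μ : ℝ} (hμ : μ ≤ 0) :
    KohnLuttinger.filling (squareDispersion 1 0) μ ≤ 1 := by
  refine (monotone_filling hμ).trans ?_
  rw [filling_eq]
  have h2 := two_mul_volume_neg_le
  rw [volume_brillouinZone, ← ENNReal.ofReal_pow (by positivity)] at h2
  have h3 : 2 * (volume (brillouinZone ∩ {p : Momentum | squareDispersion 1 0 p < 0})).toReal ≤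
      (2 * π) ^ 2 := by
    have := ENNReal.toReal_mono ENNReal.ofReal_ne_top h2
    rw [ENNReal.toReal_mul, ENNReal.toReal_ofReal (by positivity)] at this
    simpa using this
  have hπ : 0 < (2 * π) ^ 2 := by positivity
  rw [div_le_one hπ]
  exact h3

/-- Strictly below half filling: `n(μ) < 1` for `μ < 0`. [folklore] -/
theorem filling_lt_one_of_neg {μ : ℝ} (hμ : μ < 0) :
    KohnLuttinger.filling (squareDispersion 1 0) μ < 1 := by
  rcases le_or_gt μ (-4) with h | h
  · rw [filling_of_le_neg_four h]; exact one_pos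
  · exact lt_of_lt_of_le (strictMonoOn_filling ⟨h.le, by linarith⟩ ⟨by norm_num, by norm_num⟩ hμ)
      (filling_le_one_of_nonpos le_rfl)

/-! ### The window -/

/-- **Doping window ↔ chemical-potential window for the `t' = 0` band.** For
`-4 < μ₂ < μ₁ < 0` put `a = 1 - n(μ₁)`, `b = 1 - n(μ₂)`. Then `0 < a < b < 1` and for every hole
doping `δ ∈ [a, b]` the chemical potential of density `1 - δ` lies in `[μ₂, μ₁]` (the `sInf` is a
genuine inverse there, `chemicalPotentialOfDensity_spec`, and the filling is strictly increasing,
`strictMonoOn_filling`). [cite: RaghuKivelsonScalapino2010, §II (4)] -/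
theorem chemicalPotentialOfDensity_window {μ₁ μ₂ : ℝ} (h4 : -4 < μ₂) (h12 : μ₂ < μ₁) (h0 : μ₁ < 0) :
    0 < 1 - KohnLuttinger.filling (squareDispersion 1 0) μ₁ ∧
    1 - KohnLuttinger.filling (squareDispersion 1 0) μ₁ <
      1 - KohnLuttinger.filling (squareDispersion 1 0) μ₂ ∧
    1 - KohnLuttinger.filling (squareDispersion 1 0) μ₂ < 1 ∧
    ∀ δ ∈ Set.Icc (1 - KohnLuttinger.filling (squareDispersion 1 0) μ₁)
        (1 - KohnLuttinger.filling (squareDispersion 1 0) μ₂),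
      chemicalPotentialOfDensity (squareDispersion 1 0) (1 - δ) ∈ Set.Icc μ₂ μ₁ := by
  set F := KohnLuttinger.filling (squareDispersion 1 0) with hF
  have hm2 : μ₂ ∈ Set.Icc (-4 : ℝ) 4 := ⟨h4.le, by linarith⟩
  have hm1 : μ₁ ∈ Set.Icc (-4 : ℝ) 4 := ⟨by linarith, by linarith⟩
  have hm0 : (0 : ℝ) ∈ Set.Icc (-4 : ℝ) 4 := ⟨by norm_num, by norm_num⟩
  have hlt1 : F μ₁ < 1 := filling_lt_one_of_neg h0
  have hpos2 : 0 < F μ₂ := by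
    have := strictMonoOn_filling ⟨le_rfl, by norm_num⟩ hm2 h4
    rwa [filling_of_le_neg_four le_rfl] at this
  have h21 : F μ₂ < F μ₁ := strictMonoOn_filling hm2 hm1 h12
  have h10 : F μ₁ < F 0 := strictMonoOn_filling hm1 hm0 h0
  refine ⟨by linarith, by linarith, by linarith, fun δ hδ => ?_⟩
  have hn0 : 0 < 1 - δ := by linarith [hδ.2]
  have hn1 : 1 - δ < F 0 := by linarith [hδ.1]
  obtain ⟨hIoo, hfill⟩ := chemicalPotentialOfDensity_spec hn0 hn1
  set m := chemicalPotentialOfDensity (squareDispersion 1 0) (1 - δ) with hm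
  have hmI : m ∈ Set.Icc (-4 : ℝ) 4 := ⟨hIoo.1.le, by linarith [hIoo.2]⟩
  constructor
  · -- μ₂ ≤ m : otherwise F m < F μ₂ ≤ 1 - δ = F m
    by_contra hlt
    have hlt : m < μ₂ := lt_of_not_ge hlt
    have := strictMonoOn_filling hmI hm2 hlt
    rw [hfill] at this
    linarith [hδ.2]
  · -- m ≤ μ₁ : otherwise F μ₁ < F m = 1 - δ ≤ F μ₁
    by_contra hlt
    have hlt : μ₁ < m := lt_of_not_ge hlt
    have := strictMonoOn_filling hm1 hmI hlt
    rw [hfill] at this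
    linarith [hδ.1]

end Summit.HubbardSuperconductivity.HubbardSuperconductivity.Theorems

end
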